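import Literature.MathematicalPhysics.QuantumManyBody.PeriodicMaxFormGroundStates
import Literature.MathematicalPhysics.QuantumManyBody.PeriodicHardCoreTube
import HarnessLib

/-!
# The torus-side data of a finite-maximal-form state of the hard-core Bose gas

`Literature/MathematicalPhysics/QuantumManyBody` support file (everything proved; no definitions, no
named facts), namespace `Literature.MathematicalPhysics.QuantumManyBody.BoseGas`. States live in
`L²` of the Haar product probability measure `μ_H = Measure.pi (fun _ => haarAddCircle)` on
`(ℝ/ℤ)^{N×3}` (the `L2H N` of `PeriodicFormDomain`, written here without local instances), while
all real-variable statements use the global `volume` (`= μ_H`, `Torus.volume_eq_pi_haarAddCircle`). For a pair profile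
`v` with a hard core of radius `a` (`v = +∞` on `[0, a]`) in the box of side `L` and a state
`η ∈ L2H N` of finite maximal form `maxFormKin L η + maxFormPot v L η < ∞`
(`PeriodicMaxFormGroundStates`), this file extracts the real-variable data on which the hard-core
regularisation (`TorusHardCoreRegularization`) runs, in the global-`volume` convention of the torus
files (`Torus.volume_eq_pi_haarAddCircle`):

* `maxFormKin_eq_tsum_dir` — `maxFormKin L η = (2π/L)² ∑_q ∑ₙ n_q² ‖η̂(n)‖²` (directional splitting),
  hence every directional `H¹` sum is finite;
* `ae_eq_zero_on_tubes_of_maxFormPot_ne_top` — `η = 0` a.e. on the closed tubes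
  `{∃ i<j, ρᵢⱼ ≤ a/L}` (`ρᵢⱼ = Torus.pairDist`; the dictionary `PeriodicHardCoreTube`);
* (the finiteness of the tube-Hardy integrals, which needs the tube Hardy inequality of
  `TorusPairTubeHardy`, is `collar_ne_top_of_maxForm_ne_top` in `PeriodicHardCoreCutoffState`).

## Mathlib / tree search

Tree: `HaarTorus.inner_mFourierLp_eq_mFourierCoeff`, `Torus.volume_eq_pi_haarAddCircle`,
`ae_eq_zero_of_lintegral_periodicInteraction_mul_ne_top`.
-/

noncomputable section

open MeasureTheory Filter Set Complex UnitAddTorus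
open scoped ENNReal NNReal Topology InnerProductSpace
open Literature.Analysis.FunctionSpaces

namespace Literature.MathematicalPhysics.QuantumManyBody.BoseGas

variable {N : ℕ} {L : ℝ} {v : ℝ → ℝ≥0∞}

/-- Local notation for `L²((ℝ/ℤ)^{3N}, μ_H)` (the `L2H N` of `PeriodicFormDomain.lean`, Haar product
probability measure written explicitly). -/
local notation "L2H " N':max =>
  Lp ℂ 2 (Measure.pi fun _ : Fin N' × Fin 3 => (AddCircle.haarAddCircle : Measure UnitAddCircle))

/-! ## Measure bridge -/

/-- An `L2H` class is square integrable for the global `volume` (`volume = μ_H`). [folklore] -/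
theorem memLp_global (η : L2H N) : MemLp (η : UnitAddTorus (Fin N × Fin 3) → ℂ) 2 volume := by
  rw [Torus.volume_eq_pi_haarAddCircle]
  exact Lp.memLp η

/-- The potential term as a global-`volume` integral with `‖·‖ₑ`. [folklore] -/
theorem maxFormPot_eq_lintegral (v : ℝ → ℝ≥0∞) (L : ℝ) (η : L2H N) :
    maxFormPot v L η = ∫⁻ t, periodicInteraction v L (fromUnitTorusN L t) *
      ‖(η : UnitAddTorus (Fin N × Fin 3) → ℂ) t‖ₑ ^ 2 := by
  rw [Torus.volume_eq_pi_haarAddCircle]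
  simp only [enorm_eq_nnnorm]
  rfl

/-! ## The kinetic term, direction by direction -/

/-- The weight splits: `∑_p (2π n_p/L)² = (2π/L)² ∑_p n_p²` inside `ENNReal.ofReal`. [folklore] -/
theorem ofReal_weight_eq (L : ℝ) (n : Fin N × Fin 3 → ℤ) :
    ENNReal.ofReal (∑ p, (2 * Real.pi * (n p : ℝ) / L) ^ 2) =
      ENNReal.ofReal ((2 * Real.pi / L) ^ 2) * ∑ p, ENNReal.ofReal ((n p : ℝ) ^ 2) := by
  rw [← ENNReal.ofReal_sum_of_nonneg (fun _ _ => sq_nonneg _), ← ENNReal.ofReal_mul (sq_nonneg _), Finset.mul_sum]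
  congr 1
  refine Finset.sum_congr rfl fun p _ => ?_
  ring

/-- **Directional splitting of the spectral kinetic energy**:
`maxFormKin L η = (2π/L)² ∑_q ∑ₙ n_q² ‖η̂(n)‖ₑ²`. [folklore] -/
theorem maxFormKin_eq_tsum_dir (L : ℝ) (η : L2H N) :
    maxFormKin L η = ENNReal.ofReal ((2 * Real.pi / L) ^ 2) *
      ∑ q : Fin N × Fin 3, ∑' n : Fin N × Fin 3 → ℤ,
        ENNReal.ofReal ((n q : ℝ) ^ 2) * ‖mFourierCoeff (η : UnitAddTorus (Fin N × Fin 3) → ℂ) n‖ₑ ^ 2 := by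
  unfold maxFormKin
  have hcoef : ∀ n : Fin N × Fin 3 → ℤ, ((‖⟪(mFourierLp 2 n : L2H N), η⟫_ℂ‖₊ : ℝ≥0∞)) ^ 2 =
      ‖mFourierCoeff (η : UnitAddTorus (Fin N × Fin 3) → ℂ) n‖ₑ ^ 2 := fun n => by
    rw [HaarTorus.inner_mFourierLp_eq_mFourierCoeff, enorm_eq_nnnorm]
  simp only [hcoef]
  simp only [ofReal_weight_eq]
  simp only [mul_assoc, Finset.sum_mul]
  rw [ENNReal.tsum_mul_left, Summable.tsum_finsetSum (fun _ _ => ENNReal.summable)]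

/-- Each directional `H¹` sum is bounded by the kinetic energy:
`(2π/L)² ∑ₙ n_q² ‖η̂(n)‖ₑ² ≤ maxFormKin L η`. [folklore] -/
theorem mul_tsum_dir_le_maxFormKin (L : ℝ) (η : L2H N) (q : Fin N × Fin 3) :
    ENNReal.ofReal ((2 * Real.pi / L) ^ 2) * ∑' n : Fin N × Fin 3 → ℤ,
        ENNReal.ofReal ((n q : ℝ) ^ 2) * ‖mFourierCoeff (η : UnitAddTorus (Fin N × Fin 3) → ℂ) n‖ₑ ^ 2 ≤
      maxFormKin L η := by
  rw [maxFormKin_eq_tsum_dir]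
  exact mul_le_mul_right (Finset.single_le_sum (f := fun q : Fin N × Fin 3 => ∑' n : Fin N × Fin 3 → ℤ,
    ENNReal.ofReal ((n q : ℝ) ^ 2) * ‖mFourierCoeff (η : UnitAddTorus (Fin N × Fin 3) → ℂ) n‖ₑ ^ 2)
    (fun _ _ => zero_le) (Finset.mem_univ q)) _

/-- Finite kinetic energy gives finite directional `H¹` sums (`0 < L`). [folklore] -/
theorem tsum_dir_ne_top (hL : 0 < L) {η : L2H N} (hT : maxFormKin L η ≠ ⊤) (q : Fin N × Fin 3) :
    ∑' n : Fin N × Fin 3 → ℤ,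
        ENNReal.ofReal ((n q : ℝ) ^ 2) * ‖mFourierCoeff (η : UnitAddTorus (Fin N × Fin 3) → ℂ) n‖ₑ ^ 2 ≠ ⊤ := by
  intro htop
  have h := mul_tsum_dir_le_maxFormKin L η q
  rw [htop, ENNReal.mul_top (ENNReal.ofReal_pos.2 (by positivity)).ne'] at h
  exact hT (top_unique h)

/-! ## The potential term: vanishing on the tubes -/

/-- **Finite hard-core potential energy forces vanishing on the tubes**: if `v = +∞` on `[0, a]`,
`0 < L`, and `maxFormPot v L η < ∞`, then `η = 0` a.e. (global `volume`) on
`{∃ i<j, ρᵢⱼ ≤ a/L}`. [folklore] -/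
theorem ae_eq_zero_on_tubes_of_maxFormPot_ne_top (hL : 0 < L) (hvm : Measurable v) {a : ℝ}
    (hcore : ∀ ρ : ℝ, 0 ≤ ρ → ρ ≤ a → v ρ = ⊤) {η : L2H N} (hP : maxFormPot v L η ≠ ⊤) :
    ∀ᵐ t : UnitAddTorus (Fin N × Fin 3),
      (∃ i j : Fin N, i < j ∧ Torus.pairDist i j t ≤ a / L) → (η : UnitAddTorus (Fin N × Fin 3) → ℂ) t = 0 := by
  have hηm : AEStronglyMeasurable (η : UnitAddTorus (Fin N × Fin 3) → ℂ) volume := (memLp_global η).1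
  have hfin : ∫⁻ t, periodicInteraction v L (fromUnitTorusN L t) *
      ‖(η : UnitAddTorus (Fin N × Fin 3) → ℂ) t‖ₑ ^ 2 ≠ ⊤ := by
    rwa [← maxFormPot_eq_lintegral]
  filter_upwards [ae_eq_zero_of_lintegral_periodicInteraction_mul_ne_top hvm hcore hL.le hηm hfin] with t ht hex
  refine ht ?_
  obtain ⟨i, j, hij, hle⟩ := hex
  exact ⟨i, j, hij, by rwa [← le_div_iff₀' hL]⟩

/-- The open-tube form for an unordered pair `i ≠ j`: `η = 0` a.e. where `ρᵢⱼ < a/L`. [folklore] -/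
theorem ae_eq_zero_of_pairDist_lt (hL : 0 < L) (hvm : Measurable v) {a : ℝ}
    (hcore : ∀ ρ : ℝ, 0 ≤ ρ → ρ ≤ a → v ρ = ⊤) {η : L2H N} (hP : maxFormPot v L η ≠ ⊤) {i j : Fin N} (hij : i ≠ j) :
    ∀ᵐ t : UnitAddTorus (Fin N × Fin 3),
      Torus.pairDist i j t < a / L → (η : UnitAddTorus (Fin N × Fin 3) → ℂ) t = 0 := by
  filter_upwards [ae_eq_zero_on_tubes_of_maxFormPot_ne_top hL hvm hcore hP] with t ht hlt
  rcases lt_or_gt_of_ne hij with h | h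
  · exact ht ⟨i, j, h, hlt.le⟩
  · exact ht ⟨j, i, h, by rw [Torus.pairDist_comm]; exact hlt.le⟩

end Literature.MathematicalPhysics.QuantumManyBody.BoseGas

end
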